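import Literature.Analysis.FluidPDE.AxisymNoSwirlVorticity
import HarnessLib

/-!
# SwirlFreeBudget, brick for crux K-18.2 (T-18.5): the vorticity of an axisymmetric swirl-free
# field is azimuthal — POINTWISE versions off the axis (seat nsreg-p4)

Support file for the DORMANT route `SwirlThreshold` (crux stmt-NavierStokesRegularity-2002) and
planner nsreg-p2's ROUND-18 assembly task T-18.5 (`EtaMoserBound → SwirlFreePolynomialBound`,
`…Theorems.SwirlFreeBudget`): there the representative is axisymmetric and swirl free at EVERY
point (the poloidal part) but smooth only INSIDE a parabolic cylinder, so the tree's dictionary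
`‖ω‖ = r |ω_θ/r|` (`Literature.Analysis.FluidPDE.norm_curl_eq_cylRadius_mul_abs_angVortQuot`,
`curl_toroidal_of_hasNoSwirl`, which ask `ContDiff ℝ 3 v` / `ContDiff ℝ 1 v` on all of `ℝ³`)
does not apply as stated.  This file records the pointwise versions that need differentiability
AT THE POINT only:

* `curl_apply_two_eq_zero_of_differentiableAt`: `(curl v y)₂ = 0` at every `y` off the axis
  where `v` is differentiable (the tree's proof of `curl_apply_two_eq_zero`, run in the coordinate
  `y₀ ≠ 0` or `y₁ ≠ 0`; no continuity argument);
* `norm_curl_eq_abs_swirl_curl_div`: **`‖curl v y‖ = |swirl (curl v) y| / r`** off the axis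
  (`ω_r = 0` is the tree's pointwise `inner_curl_horizontal_eq_zero`; Lagrange's identity),
  i.e. `|ω| = |ω_θ|` with `ω_θ = swirl(curl v)/r`; and `norm_curl_le_of_abs_swirl_curl_le`, the
  form consumed by the local Helmholtz sup bound `exists_const_norm_le_of_curl_le_local`.

WHAT THIS IS NOT: not NS regularity — pointwise linear algebra on the symmetry relations;
`EtaMoserBound`, `SwirlFreePolynomialBound` and all hard cores untouched; no crux claim.
-/

namespace Summit.NavierStokesRegularity.NavierStokesRegularity.Theorems.SwirlFreeBudget

open Set
open scoped RealInnerProductSpace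
open Literature.Analysis Literature.Analysis.FluidPDE

noncomputable section

variable {v : EuclideanSpace ℝ (Fin 3) → EuclideanSpace ℝ (Fin 3)}

/-- **`ω_z = 0` pointwise**: for `v` axisymmetric and swirl free (everywhere) and differentiable at
a point `y` OFF the axis, `(curl v y)₂ = 0`. -/
theorem curl_apply_two_eq_zero_of_differentiableAt (hax : IsAxisymmetric v) (hsw : HasNoSwirl v)
    {y : EuclideanSpace ℝ (Fin 3)} (hd : DifferentiableAt ℝ v y) (hy : cylRadius y ≠ 0) :
    curl v y 2 = 0 := by
  set D := fderiv ℝ v y with hD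
  -- the swirl relations `⟪Jy, D h⟫ = -⟪Jh, v⟫` for `h = e₀, e₁`
  have h1 := hsw.inner_rotGen_fderiv_apply hd (EuclideanSpace.single 0 1)
  have h2 := hsw.inner_rotGen_fderiv_apply hd (EuclideanSpace.single 1 1)
  rw [rotGen_single_zero, inner_rotGen_left] at h1
  rw [rotGen_single_one, inner_rotGen_left, inner_neg_left] at h2
  have e1 : ⟪(EuclideanSpace.single (1 : Fin 3) (1 : ℝ)), v y⟫ = v y 1 := by simp [PiLp.inner_apply]
  have e0 : ⟪(EuclideanSpace.single (0 : Fin 3) (1 : ℝ)), v y⟫ = v y 0 := by simp [PiLp.inner_apply]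
  rw [e1] at h1
  rw [e0] at h2
  -- infinitesimal axisymmetry `D(Jy) = J(v y)`, components 0 and 1
  have h3 := hax.fderiv_rotGen hd
  have h30 := congrFun (congrArg (⇑) h3) 0
  have h31 := congrFun (congrArg (⇑) h3) 1
  rw [rotGen_eq_sub_single y, map_sub, map_smul, map_smul] at h30 h31
  simp only [PiLp.sub_apply, PiLp.smul_apply, smul_eq_mul, rotGen_apply_zero, rotGen_apply_one] at h30 h31
  rw [curl_apply_two]
  rw [← hD] at h1 h2 h30 h31 ⊢
  -- `y₀ · ω_z = 0` and `y₁ · ω_z = 0`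
  have k0 : y 0 * (D (EuclideanSpace.single 0 1) 1 - D (EuclideanSpace.single 1 1) 0) = 0 := by
    linarith
  have k1 : y 1 * (D (EuclideanSpace.single 0 1) 1 - D (EuclideanSpace.single 1 1) 0) = 0 := by
    linarith
  by_cases hy0 : y 0 = 0
  · have hy1 : y 1 ≠ 0 := fun h => hy ((cylRadius_eq_zero_iff y).2 ⟨hy0, h⟩)
    exact (mul_eq_zero.1 k1).resolve_left hy1
  · exact (mul_eq_zero.1 k0).resolve_left hy0

/-- **`|ω| = |ω_θ|` pointwise**: for `v` axisymmetric and swirl free and differentiable at `y` off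
the axis, `‖curl v y‖ = |swirl (curl v) y| / r(y)` (`swirl (curl v) = y₀ω₁ - y₁ω₀ = r ω_θ`;
`ω_r = 0` by `inner_curl_horizontal_eq_zero`, `ω_z = 0` by the previous lemma, and Lagrange's
identity `(y₀ω₁ - y₁ω₀)² + (y₀ω₀ + y₁ω₁)² = r²(ω₀² + ω₁²)`). -/
theorem norm_curl_eq_abs_swirl_curl_div (hax : IsAxisymmetric v) (hsw : HasNoSwirl v)
    {y : EuclideanSpace ℝ (Fin 3)} (hd : DifferentiableAt ℝ v y) (hy : cylRadius y ≠ 0) :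
    ‖curl v y‖ = |swirl (curl v) y| / cylRadius y := by
  have hr : 0 < cylRadius y := lt_of_le_of_ne (cylRadius_nonneg y) (Ne.symm hy)
  have hrad := inner_curl_horizontal_eq_zero hax hsw hd
  have hz := curl_apply_two_eq_zero_of_differentiableAt hax hsw hd hy
  have hsq : ‖curl v y‖ ^ 2 = (swirl (curl v) y / cylRadius y) ^ 2 := by
    rw [EuclideanSpace.real_norm_sq_eq, Fin.sum_univ_three, hz, div_pow, cylRadius_sq,
      eq_div_iff (by rw [← cylRadius_sq]; exact pow_ne_zero 2 hy)]
    simp only [swirl]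
    nlinarith [hrad]
  have h1 : ‖curl v y‖ = |swirl (curl v) y / cylRadius y| := by
    rw [← Real.sqrt_sq (norm_nonneg _), hsq, Real.sqrt_sq_eq_abs]
  rw [h1, abs_div, abs_of_pos hr]

/-- The form consumed by the local Helmholtz bound: off the axis, a bound `|swirl (curl v) y| ≤ Λ r`
(i.e. `|ω_θ| ≤ Λ`, e.g. `|ω_θ/r| ≤ Λ/r`) gives `‖curl v y‖ ≤ Λ`. -/
theorem norm_curl_le_of_abs_swirl_curl_le (hax : IsAxisymmetric v) (hsw : HasNoSwirl v)
    {y : EuclideanSpace ℝ (Fin 3)} (hd : DifferentiableAt ℝ v y) (hy : cylRadius y ≠ 0) {Λ : ℝ}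
    (hΛ : |swirl (curl v) y| ≤ Λ * cylRadius y) : ‖curl v y‖ ≤ Λ := by
  have hr : 0 < cylRadius y := lt_of_le_of_ne (cylRadius_nonneg y) (Ne.symm hy)
  rw [norm_curl_eq_abs_swirl_curl_div hax hsw hd hy, div_le_iff₀ hr]
  exact hΛ

end

end Summit.NavierStokesRegularity.NavierStokesRegularity.Theorems.SwirlFreeBudget
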